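import Summits.CriticalPhenomena.CardyFormulaZ2.Theses.CardyFlipRusso
import HarnessLib

/-!
# Sketch — crux idea `switching-null` (strategist r1, crux `CardyFlipRusso.CoveringLeg`, stmt-CriticalPhenomena-6435)

First lemma of the idea: the **odd five-arm null** for fair site percolation on the centred square
lattice `G_s` (a planar triangulation, so Aizenman–Duplantier–Aharony / Nolin colour switching is exact):
for every conformal rectangle, the expected number of sites carrying the alternating four arms to the
four arcs PLUS a fifth disjoint BLACK arm to the boundary, minus the same with a fifth WHITE arm, tends
to `0` with the mesh.  (Sector by sector the two probabilities are EQUAL at every mesh — conditioning on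
the two extremal interfaces from opposite corners and flipping the unexplored sector; the union over
sectors differs by six-arm terms only.)  Site type, embedding `z` and graph `G` are copied verbatim from
the crux `CoveringLeg`.
-/

namespace Summit.CriticalPhenomena.CardyFormulaZ2.Cruxes.CoveringLeg.SwitchingNull

open scoped Topology
open Filter Set MeasureTheory

/-- The odd five-arm functional of fair site percolation on `G_s` vanishes in the scaling limit, for every
conformal rectangle (natural events: four alternating arms from neighbours of `v` to the four arcs inside
`R`, carried by pairwise disjoint vertex sets avoiding `v`, plus a fifth disjoint arm of colour `c` to the
boundary; `c = true` black/open, `c = false` white/closed). -/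
def OddFiveArmNull : Prop :=
  let V := (ℤ × ℤ) ⊕ (ℤ × ℤ)
  let z : V → ℂ := Sum.elim (fun x ↦ (x.1 : ℂ) + (x.2 : ℂ) * Complex.I)
    (fun f ↦ ((f.1 : ℂ) + 1 / 2) + ((f.2 : ℂ) + 1 / 2) * Complex.I)
  let G : SimpleGraph V := SimpleGraph.fromRel (fun a b ↦ a.isLeft = true ∧
    ((b.isLeft = true ∧ dist (z a) (z b) = 1) ∨ (b.isRight = true ∧ dist (z a) (z b) < 1)))
  let P : Measure (Literature.Probability.Percolation.SiteConfig V) :=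
    Literature.Probability.Percolation.sitePercolation V Literature.Probability.Percolation.half
  -- monochromatic arm of colour `c` from `u` to `w` inside the vertex set `A ∩ (δ-rescaled preimage of R)`
  let arm : Literature.Probability.RandomPlanarGeometry.ConformalRectangle → ℝ → Bool → Set V → V → V →
      Set (Literature.Probability.Percolation.SiteConfig V) :=
    fun R δ c A u w ↦ {ω | (if c then ω else ωᶜ) ∈
      Literature.Probability.Percolation.siteConnIn G (A ∩ {y | (δ : ℂ) * z y ∈ R.carrier}) u w}
  -- the five-arm event at `v` with fifth arm of colour `c`
  let five : Literature.Probability.RandomPlanarGeometry.ConformalRectangle → ℝ → Bool → V →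
      Set (Literature.Probability.Percolation.SiteConfig V) :=
    fun R δ c v ↦ {ω | ∃ (u w : Fin 5 → V) (A : Fin 5 → Set V),
      Pairwise (Function.onFun Disjoint A) ∧ (∀ i, v ∉ A i ∧ G.Adj v (u i)) ∧
      Metric.infDist ((δ : ℂ) * z (w 0)) (R.arc 0) ≤ 2 * δ ∧
      Metric.infDist ((δ : ℂ) * z (w 1)) (R.arc 1) ≤ 2 * δ ∧
      Metric.infDist ((δ : ℂ) * z (w 2)) (R.arc 2) ≤ 2 * δ ∧
      Metric.infDist ((δ : ℂ) * z (w 3)) (R.arc 3) ≤ 2 * δ ∧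
      Metric.infDist ((δ : ℂ) * z (w 4)) R.carrierᶜ ≤ 2 * δ ∧
      ω ∈ arm R δ true (A 0) (u 0) (w 0) ∧ ω ∈ arm R δ false (A 1) (u 1) (w 1) ∧
      ω ∈ arm R δ true (A 2) (u 2) (w 2) ∧ ω ∈ arm R δ false (A 3) (u 3) (w 3) ∧
      ω ∈ arm R δ c (A 4) (u 4) (w 4)}
  ∀ R : Literature.Probability.RandomPlanarGeometry.ConformalRectangle,
    Tendsto (fun δ : ℝ ↦ ∑' v : V, (P.real (five R δ true v) - P.real (five R δ false v)))
      (𝓝[>] 0) (𝓝 0)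

/- Sector-wise EXACT form (the lattice identity behind `OddFiveArmNull`, informal): with the fifth arm required to
sit in the sector between the arm to `arc 0` and the arm to `arc 1`, black and white fifth arms are EQUIPROBABLE at every
mesh, for every domain and every `v` — explore the interfaces from the corners `pt 0` and `pt 2` up to `v` (they reach `v`
iff the four-arm event holds and reveal only the four extremal arms) and flip the unexplored sector between the black
extremal arm to `arc 0` and the white extremal arm to `arc 1`.  Verified exhaustively on the radius-2 hexagonal patch of
the triangular lattice (2^18 colourings, three arc geometries): equal counts sector by sector. -/

end Summit.CriticalPhenomena.CardyFormulaZ2.Cruxes.CoveringLeg.SwitchingNull
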